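import Mathlib.Data.Real.Basic
import Mathlib.Algebra.Order.AbsoluteValue.Basic
import Mathlib.Algebra.BigOperators.Group.List.Basic
import Mathlib.Algebra.BigOperators.Ring.Finset
import Mathlib.Algebra.Order.BigOperators.Group.Finset
import Mathlib.Tactic.Ring
import Mathlib.Tactic.Positivity
import Mathlib.Tactic.Linarith
import HarnessLib

/-!
# A small reflective checker for trivariate polynomial certificates

Kernel-evaluable (structurally recursive, `List`-based) sparse polynomials in three variables
with integer coefficients, their real evaluation semantics, and the soundness lemmas needed to
turn a successful `decide` run into real inequalities:

* `Mono`, `SPoly` (lists of terms, duplicates allowed), `SPoly.eval`, closure under `+`, `*`, scalars;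
* `CTree`: accumulation of terms into a binary trie keyed by a monomial code, detecting key
  collisions (`Option`), with `CTree.eval_insAll` (the accumulated tree evaluates like the list) and
  `CTree.abs_eval_le` (on the box `|u|,|v|,|t| ≤ 1` the value is bounded by the sum of the absolute
  values of the coefficients);
* `sqSum`: sums of `d_c · ℓ_c²` with `d_c ≥ 0`, evaluating to a nonnegative real.

Everything here is elementary bookkeeping [folklore]; it is the verification back-end for the
sum-of-squares certificates of the three-point bound for the kissing number in four dimensions.
-/

namespace Literature.Geometry.DiscreteGeometry

namespace PolyCert

/-- A monomial `u^a v^b t^c`. [folklore] -/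
structure Mono where
  /-- exponent of `u` -/
  a : ℕ
  /-- exponent of `v` -/
  b : ℕ
  /-- exponent of `t` -/
  c : ℕ
deriving DecidableEq, Repr

namespace Mono

/-- Real value of a monomial. [folklore] -/
def eval (m : Mono) (u v t : ℝ) : ℝ := u ^ m.a * v ^ m.b * t ^ m.c

/-- Product of monomials. [folklore] -/
def mul (m n : Mono) : Mono := ⟨m.a + n.a, m.b + n.b, m.c + n.c⟩

/-- `eval` is multiplicative. [folklore] -/
theorem eval_mul (m n : Mono) (u v t : ℝ) :
    (m.mul n).eval u v t = m.eval u v t * n.eval u v t := by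
  simp only [eval, mul, pow_add]; ring

/-- On the unit box a monomial has absolute value `≤ 1`. [folklore] -/
theorem abs_eval_le_one (m : Mono) {u v t : ℝ} (hu : |u| ≤ 1) (hv : |v| ≤ 1) (ht : |t| ≤ 1) :
    |m.eval u v t| ≤ 1 := by
  simp only [eval, abs_mul, abs_pow]
  have h1 : |u| ^ m.a ≤ 1 := pow_le_one₀ (abs_nonneg _) hu
  have h2 : |v| ^ m.b ≤ 1 := pow_le_one₀ (abs_nonneg _) hv
  have h3 : |t| ^ m.c ≤ 1 := pow_le_one₀ (abs_nonneg _) ht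
  calc |u| ^ m.a * |v| ^ m.b * |t| ^ m.c ≤ 1 * 1 * 1 := by
        gcongr
    _ = 1 := by ring

/-- Key used to place a monomial in the accumulation trie (need not be injective). [folklore] -/
def key (m : Mono) : ℕ := m.a + 32 * m.b + 1024 * m.c

end Mono

/-- Sparse polynomials: lists of terms (monomial, integer coefficient); duplicates allowed.
[folklore] -/
abbrev SPoly := List (Mono × ℤ)

namespace SPoly

/-- Real value of a term list. [folklore] -/
def eval (p : SPoly) (u v t : ℝ) : ℝ := (p.map fun mc => (mc.2 : ℝ) * mc.1.eval u v t).sum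

/-- `eval` of the empty list. [folklore] -/
@[simp] theorem eval_nil (u v t : ℝ) : eval [] u v t = 0 := by simp [eval]

/-- `eval` of a cons. [folklore] -/
@[simp] theorem eval_cons (mc : Mono × ℤ) (p : SPoly) (u v t : ℝ) :
    eval (mc :: p) u v t = (mc.2 : ℝ) * mc.1.eval u v t + eval p u v t := by
  simp [eval]

/-- `eval` is additive over concatenation. [folklore] -/
@[simp] theorem eval_append (p q : SPoly) (u v t : ℝ) :
    eval (p ++ q) u v t = eval p u v t + eval q u v t := by
  simp [eval, List.sum_append]

/-- Scalar multiple. [folklore] -/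
def smul (c : ℤ) (p : SPoly) : SPoly := p.map fun mc => (mc.1, c * mc.2)

/-- `eval` of a scalar multiple. [folklore] -/
@[simp] theorem eval_smul (c : ℤ) (p : SPoly) (u v t : ℝ) :
    eval (smul c p) u v t = (c : ℝ) * eval p u v t := by
  induction p with
  | nil => simp [smul]
  | cons mc p ih =>
    simp only [smul, List.map_cons] at *
    rw [eval_cons, eval_cons, ih]
    push_cast; ring

/-- Multiply every term by a monomial and an integer. [folklore] -/
def mulMono (m : Mono) (c : ℤ) (p : SPoly) : SPoly := p.map fun nc => (m.mul nc.1, c * nc.2)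

/-- `eval` of `mulMono`. [folklore] -/
@[simp] theorem eval_mulMono (m : Mono) (c : ℤ) (p : SPoly) (u v t : ℝ) :
    eval (mulMono m c p) u v t = (c : ℝ) * m.eval u v t * eval p u v t := by
  induction p with
  | nil => simp [mulMono]
  | cons nc p ih =>
    simp only [mulMono, List.map_cons] at *
    rw [eval_cons, eval_cons, ih, Mono.eval_mul]
    push_cast; ring

/-- Product of term lists. [folklore] -/
def mul (p q : SPoly) : SPoly := p.flatMap fun mc => mulMono mc.1 mc.2 q

/-- `eval` is multiplicative. [folklore] -/
@[simp] theorem eval_mul (p q : SPoly) (u v t : ℝ) :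
    eval (mul p q) u v t = eval p u v t * eval q u v t := by
  induction p with
  | nil => simp [mul]
  | cons mc p ih =>
    simp only [mul, List.flatMap_cons] at *
    rw [eval_append, ih, eval_mulMono, eval_cons]
    ring

/-- Power by repeated multiplication. [folklore] -/
def pow (p : SPoly) : ℕ → SPoly
  | 0 => [(⟨0, 0, 0⟩, 1)]
  | n + 1 => mul (pow p n) p

/-- `eval` of `pow`. [folklore] -/
@[simp] theorem eval_pow (p : SPoly) (n : ℕ) (u v t : ℝ) :
    eval (pow p n) u v t = eval p u v t ^ n := by
  induction n with
  | zero => simp [pow, eval, Mono.eval]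
  | succ n ih => rw [pow, eval_mul, ih, pow_succ]

/-- Constant polynomial. [folklore] -/
def C (c : ℤ) : SPoly := [(⟨0, 0, 0⟩, c)]

/-- `eval` of a constant. [folklore] -/
@[simp] theorem eval_C (c : ℤ) (u v t : ℝ) : eval (C c) u v t = c := by
  simp [C, eval, Mono.eval]

/-- The variable `u`. [folklore] -/
def U : SPoly := [(⟨1, 0, 0⟩, 1)]
/-- The variable `v`. [folklore] -/
def V : SPoly := [(⟨0, 1, 0⟩, 1)]
/-- The variable `t`. [folklore] -/
def T : SPoly := [(⟨0, 0, 1⟩, 1)]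

/-- `eval U = u`. [folklore] -/
@[simp] theorem eval_U (u v t : ℝ) : eval U u v t = u := by simp [U, eval, Mono.eval]
/-- `eval V = v`. [folklore] -/
@[simp] theorem eval_V (u v t : ℝ) : eval V u v t = v := by simp [V, eval, Mono.eval]
/-- `eval T = t`. [folklore] -/
@[simp] theorem eval_T (u v t : ℝ) : eval T u v t = t := by simp [T, eval, Mono.eval]

/-- Sum of a list of term lists. [folklore] -/
def lsum : List SPoly → SPoly
  | [] => []
  | p :: ps => p ++ lsum ps

/-- `eval` of `lsum`. [folklore] -/
@[simp] theorem eval_lsum (ps : List SPoly) (u v t : ℝ) :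
    eval (lsum ps) u v t = (ps.map fun p => eval p u v t).sum := by
  induction ps with
  | nil => simp [lsum]
  | cons p ps ih => simp [lsum, ih]

/-- Sum of absolute values of the coefficients. [folklore] -/
def absSum (p : SPoly) : ℕ := (p.map fun mc => mc.2.natAbs).sum

/-- On the unit box, `|eval p| ≤ absSum p`. [folklore] -/
theorem abs_eval_le (p : SPoly) {u v t : ℝ} (hu : |u| ≤ 1) (hv : |v| ≤ 1) (ht : |t| ≤ 1) :
    |eval p u v t| ≤ absSum p := by
  induction p with
  | nil => simp [absSum]
  | cons mc p ih =>
    rw [eval_cons]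
    simp only [absSum, List.map_cons, List.sum_cons, Nat.cast_add] at *
    refine (abs_add_le _ _).trans (add_le_add ?_ ih)
    rw [abs_mul]
    calc |(mc.2 : ℝ)| * |mc.1.eval u v t| ≤ |(mc.2 : ℝ)| * 1 := by
          gcongr; exact Mono.abs_eval_le_one _ hu hv ht
      _ = (mc.2.natAbs : ℝ) := by simp [Nat.cast_natAbs, Int.cast_abs]


/-- Negation. [folklore] -/
def neg (p : SPoly) : SPoly := smul (-1) p

/-- `eval` of `neg`. [folklore] -/
@[simp] theorem eval_neg (p : SPoly) (u v t : ℝ) : eval (neg p) u v t = -eval p u v t := by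
  simp [neg]

/-- Lexicographic comparison key of monomials. [folklore] -/
def monoLt (m n : Mono) : Bool :=
  m.a < n.a || (m.a == n.a && (m.b < n.b || (m.b == n.b && m.c < n.c)))

/-- Merge two term lists adding coefficients of equal adjacent monomials (fuel-bounded; exact merging
is only an efficiency matter, the value is always preserved). [folklore] -/
def mergeAdd : ℕ → SPoly → SPoly → SPoly
  | 0, p, q => p ++ q
  | _ + 1, [], q => q
  | _ + 1, p, [] => p
  | n + 1, (m, c) :: p, (m', c') :: q =>
      if m = m' then (m, c + c') :: mergeAdd n p q
      else if monoLt m m' then (m, c) :: mergeAdd n p ((m', c') :: q)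
      else (m', c') :: mergeAdd n ((m, c) :: p) q

/-- `mergeAdd` preserves the value. [folklore] -/
@[simp] theorem eval_mergeAdd (n : ℕ) (p q : SPoly) (u v t : ℝ) :
    eval (mergeAdd n p q) u v t = eval p u v t + eval q u v t := by
  induction n generalizing p q with
  | zero => simp [mergeAdd]
  | succ n ih =>
    cases p with
    | nil => simp [mergeAdd]
    | cons mc p =>
      cases q with
      | nil => simp [mergeAdd]
      | cons mc' q =>
        obtain ⟨m, c⟩ := mc
        obtain ⟨m', c'⟩ := mc'
        simp only [mergeAdd]
        split_ifs with h1 h2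
        · subst h1; rw [eval_cons, ih, eval_cons, eval_cons]; push_cast; ring
        · rw [eval_cons, ih, eval_cons, eval_cons]; ring
        · rw [eval_cons, ih, eval_cons, eval_cons]; ring

/-- Merge-sum of a list of term lists (left fold of `mergeAdd`). [folklore] -/
def mergeAll : List SPoly → SPoly
  | [] => []
  | p :: ps => mergeAdd (p.length + (mergeAll ps).length) p (mergeAll ps)

/-- `mergeAll` evaluates to the sum. [folklore] -/
@[simp] theorem eval_mergeAll (ps : List SPoly) (u v t : ℝ) :
    eval (mergeAll ps) u v t = (ps.map fun p => eval p u v t).sum := by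
  induction ps with
  | nil => simp [mergeAll]
  | cons p ps ih => simp [mergeAll, ih]

/-- Substitute `(u, v, t) ↦ (u, u, 1)`: the monomial `u^a v^b t^c` becomes `u^{a+b}`. [folklore] -/
def substUU1 (p : SPoly) : SPoly := p.map fun mc => (⟨mc.1.a + mc.1.b, 0, 0⟩, mc.2)

/-- `eval (substUU1 p) s v t = eval p s s 1`. [folklore] -/
theorem eval_substUU1 (p : SPoly) (s v t : ℝ) : eval (substUU1 p) s v t = eval p s s 1 := by
  induction p with
  | nil => simp [substUU1]
  | cons mc p ih =>
    simp only [substUU1, List.map_cons] at *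
    rw [eval_cons, eval_cons, ih]
    simp only [Mono.eval, pow_zero, mul_one, one_pow, pow_add]

/-- Exponent permutation `u^a v^b t^c ↦ u^b v^a t^c` (swap `u ↔ v`). [folklore] -/
def permBAC (p : SPoly) : SPoly := p.map fun mc => (⟨mc.1.b, mc.1.a, mc.1.c⟩, mc.2)
/-- Exponent permutation `u^a v^b t^c ↦ u^c v^b t^a` (swap `u ↔ t`). [folklore] -/
def permCBA (p : SPoly) : SPoly := p.map fun mc => (⟨mc.1.c, mc.1.b, mc.1.a⟩, mc.2)
/-- Exponent permutation `u^a v^b t^c ↦ u^a v^c t^b` (swap `v ↔ t`). [folklore] -/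
def permACB (p : SPoly) : SPoly := p.map fun mc => (⟨mc.1.a, mc.1.c, mc.1.b⟩, mc.2)
/-- Exponent permutation `u^a v^b t^c ↦ u^b v^c t^a`. [folklore] -/
def permBCA (p : SPoly) : SPoly := p.map fun mc => (⟨mc.1.b, mc.1.c, mc.1.a⟩, mc.2)
/-- Exponent permutation `u^a v^b t^c ↦ u^c v^a t^b`. [folklore] -/
def permCAB (p : SPoly) : SPoly := p.map fun mc => (⟨mc.1.c, mc.1.a, mc.1.b⟩, mc.2)

/-- `eval (permBAC p) u v t = eval p v u t`. [folklore] -/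
@[simp] theorem eval_permBAC (p : SPoly) (u v t : ℝ) : eval (permBAC p) u v t = eval p v u t := by
  induction p with
  | nil => simp [permBAC]
  | cons mc p ih =>
    simp only [permBAC, List.map_cons] at *; rw [eval_cons, eval_cons, ih]; simp only [Mono.eval]; ring

/-- `eval (permCBA p) u v t = eval p t v u`. [folklore] -/
@[simp] theorem eval_permCBA (p : SPoly) (u v t : ℝ) : eval (permCBA p) u v t = eval p t v u := by
  induction p with
  | nil => simp [permCBA]
  | cons mc p ih =>
    simp only [permCBA, List.map_cons] at *; rw [eval_cons, eval_cons, ih]; simp only [Mono.eval]; ring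

/-- `eval (permACB p) u v t = eval p u t v`. [folklore] -/
@[simp] theorem eval_permACB (p : SPoly) (u v t : ℝ) : eval (permACB p) u v t = eval p u t v := by
  induction p with
  | nil => simp [permACB]
  | cons mc p ih =>
    simp only [permACB, List.map_cons] at *; rw [eval_cons, eval_cons, ih]; simp only [Mono.eval]; ring

/-- `eval (permBCA p) u v t = eval p t u v`. [folklore] -/
@[simp] theorem eval_permBCA (p : SPoly) (u v t : ℝ) : eval (permBCA p) u v t = eval p t u v := by
  induction p with
  | nil => simp [permBCA]
  | cons mc p ih =>
    simp only [permBCA, List.map_cons] at *; rw [eval_cons, eval_cons, ih]; simp only [Mono.eval]; ring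

/-- `eval (permCAB p) u v t = eval p v t u`. [folklore] -/
@[simp] theorem eval_permCAB (p : SPoly) (u v t : ℝ) : eval (permCAB p) u v t = eval p v t u := by
  induction p with
  | nil => simp [permCAB]
  | cons mc p ih =>
    simp only [permCAB, List.map_cons] at *; rw [eval_cons, eval_cons, ih]; simp only [Mono.eval]; ring

/-! ### Quadratic forms in a monomial basis and their Gram certificates -/

/-- Sums over `List.range` as `Finset.range` sums. [folklore] -/
theorem list_sum_map_range (f : ℕ → ℝ) (n : ℕ) :
    ((List.range n).map f).sum = ∑ i ∈ Finset.range n, f i := by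
  induction n with
  | zero => simp
  | succ n ih => rw [List.range_succ, List.map_append, List.sum_append, ih, Finset.sum_range_succ]; simp

/-- `i`-th basis monomial (default `1`). [folklore] -/
def getMono (z : List Mono) (i : ℕ) : Mono := z.getD i ⟨0, 0, 0⟩
/-- `i`-th row of an integer matrix (default empty). [folklore] -/
def getRow (G : List (List ℤ)) (i : ℕ) : List ℤ := G.getD i []
/-- Entry `(i, j)` of an integer matrix (default `0`). [folklore] -/
def getEntry (G : List (List ℤ)) (i j : ℕ) : ℤ := (getRow G i).getD j 0

/-- The quadratic form `Σ_{i,j<n} G_{ij} z_i z_j` as a term list. [folklore] -/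
def quadMono (G : List (List ℤ)) (z : List Mono) (n : ℕ) : SPoly :=
  mergeAll ((List.range n).map fun i =>
    (List.range n).map fun j => ((getMono z i).mul (getMono z j), getEntry G i j))

/-- Value of `quadMono`. [folklore] -/
theorem eval_quadMono (G : List (List ℤ)) (z : List Mono) (n : ℕ) (u v t : ℝ) :
    eval (quadMono G z n) u v t = ∑ i ∈ Finset.range n, ∑ j ∈ Finset.range n,
      (getEntry G i j : ℝ) * ((getMono z i).eval u v t * (getMono z j).eval u v t) := by
  rw [quadMono, eval_mergeAll, List.map_map]
  rw [show ((List.range n).map ((fun p => eval p u v t) ∘ fun i =>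
      (List.range n).map fun j => ((getMono z i).mul (getMono z j), getEntry G i j))) =
      (List.range n).map (fun i => ∑ j ∈ Finset.range n,
        (getEntry G i j : ℝ) * ((getMono z i).eval u v t * (getMono z j).eval u v t)) from ?_]
  · exact list_sum_map_range _ n
  refine List.map_congr_left fun i _ => ?_
  simp only [Function.comp, eval, List.map_map]
  rw [← list_sum_map_range]
  congr 1
  refine List.map_congr_left fun j _ => ?_
  simp [Mono.eval_mul]

/-- Dot product of integer lists (truncating to the shorter). [folklore] -/
def dotL (a b : List ℤ) : ℤ := (List.zipWith (· * ·) a b).sum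

/-- `dotL` as a `Finset.range` sum of `getD` entries. [folklore] -/
theorem dotL_eq_sum (a b : List ℤ) (m : ℕ) (ha : a.length ≤ m) (hb : b.length ≤ m) :
    dotL a b = ∑ c ∈ Finset.range m, a.getD c 0 * b.getD c 0 := by
  induction a generalizing b m with
  | nil => simp [dotL]
  | cons x a ih =>
    cases b with
    | nil => simp [dotL]
    | cons y b =>
      cases m with
      | zero => simp at ha
      | succ m =>
        simp only [List.length_cons, Nat.succ_le_succ_iff] at ha hb
        rw [Finset.sum_range_succ', show dotL (x :: a) (y :: b) = x * y + dotL a b by simp [dotL],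
          ih b m ha hb]
        simp [add_comm]

/-- The Gram check: `G = L Lᵀ + diag(D)` entrywise on `n × n` with `D ≥ 0`, where `L` has rows of
length `≤ m`. [folklore] -/
def gramOK (G L : List (List ℤ)) (D : List ℤ) (n m : ℕ) : Bool :=
  ((List.range n).all fun i => decide ((getRow L i).length ≤ m)) &&
  ((List.range n).all fun i => decide (0 ≤ D.getD i 0)) &&
  ((List.range n).all fun i => (List.range n).all fun j =>
    getEntry G i j == dotL (getRow L i) (getRow L j) + (if i = j then D.getD i 0 else 0))

/-- Soundness of the Gram check: the quadratic form is a weighted sum of squares, hence `≥ 0`.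
[folklore] -/
theorem quadMono_nonneg_of_gramOK (G L : List (List ℤ)) (D : List ℤ) (z : List Mono) (n m : ℕ)
    (h : gramOK G L D n m = true) (u v t : ℝ) : 0 ≤ eval (quadMono G z n) u v t := by
  simp only [gramOK, Bool.and_eq_true, List.all_eq_true, List.mem_range, decide_eq_true_eq,
    beq_iff_eq] at h
  obtain ⟨⟨hlen, hD⟩, hG⟩ := h
  rw [eval_quadMono]
  set zz : ℕ → ℝ := fun i => (getMono z i).eval u v t
  set Lr : ℕ → ℕ → ℝ := fun i c => ((getRow L i).getD c 0 : ℝ)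
  have hentry : ∀ i ∈ Finset.range n, ∀ j ∈ Finset.range n, (getEntry G i j : ℝ) =
      (∑ c ∈ Finset.range m, Lr i c * Lr j c) + (if i = j then (D.getD i 0 : ℝ) else 0) := by
    intro i hi j hj
    rw [Finset.mem_range] at hi hj
    have h0 := hG i hi j hj
    rw [dotL_eq_sum _ _ m (hlen i hi) (hlen j hj)] at h0
    rw [h0]
    simp only [Lr, Int.cast_add, Int.cast_sum, Int.cast_mul]
    split_ifs <;> simp
  calc (0 : ℝ) ≤ (∑ c ∈ Finset.range m, (∑ i ∈ Finset.range n, Lr i c * zz i) ^ 2)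
        + ∑ i ∈ Finset.range n, (D.getD i 0 : ℝ) * zz i ^ 2 := by
        refine add_nonneg (Finset.sum_nonneg fun c _ => sq_nonneg _)
          (Finset.sum_nonneg fun i hi => mul_nonneg ?_ (sq_nonneg _))
        exact_mod_cast hD i (Finset.mem_range.1 hi)
    _ = ∑ i ∈ Finset.range n, ∑ j ∈ Finset.range n, (getEntry G i j : ℝ) * (zz i * zz j) := by
        rw [Finset.sum_congr rfl fun i hi => Finset.sum_congr rfl fun j hj => by
          rw [hentry i hi j hj]]
        simp only [add_mul, Finset.sum_add_distrib]
        congr 1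
        · -- Σ_c (Σ_i L_ic z_i)^2 = Σ_i Σ_j (Σ_c L_ic L_jc) z_i z_j
          rw [Finset.sum_comm]
          simp only [sq, Finset.sum_mul, Finset.mul_sum]
          rw [Finset.sum_comm]
          refine Finset.sum_congr rfl fun i _ => ?_
          rw [Finset.sum_comm]
          refine Finset.sum_congr rfl fun j _ => Finset.sum_congr rfl fun c _ => ?_
          ring
        · -- diagonal
          refine Finset.sum_congr rfl fun i hi => ?_
          simp only [ite_mul, zero_mul, Finset.sum_ite_eq, if_pos hi]
          ring

end SPoly

/-! ### Accumulation trie -/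

/-- Binary trie of terms keyed by the bits of `Mono.key`. [folklore] -/
inductive CTree where
  | empty : CTree
  | leaf (m : Mono) (c : ℤ) : CTree
  | node (l r : CTree) : CTree

namespace CTree

/-- Real value: sum of the leaves. [folklore] -/
def eval : CTree → ℝ → ℝ → ℝ → ℝ
  | empty, _, _, _ => 0
  | leaf m c, u, v, t => (c : ℝ) * m.eval u v t
  | node l r, u, v, t => l.eval u v t + r.eval u v t

/-- Insert a term following `depth` bits of `key`; `none` on a collision of distinct monomials.
[folklore] -/
def ins : ℕ → ℕ → Mono → ℤ → CTree → Option CTree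
  | 0, _, m, c, empty => some (leaf m c)
  | 0, _, m, c, leaf m' c' => if m = m' then some (leaf m (c' + c)) else none
  | 0, _, _, _, node _ _ => none
  | _ + 1, _, _, _, leaf _ _ => none
  | d + 1, key, m, c, empty =>
      if key % 2 = 0 then (ins d (key / 2) m c empty).map fun l => node l empty
      else (ins d (key / 2) m c empty).map fun r => node empty r
  | d + 1, key, m, c, node l r =>
      if key % 2 = 0 then (ins d (key / 2) m c l).map fun l' => node l' r
      else (ins d (key / 2) m c r).map fun r' => node l r'

/-- Inserting a term adds its value. [folklore] -/
theorem eval_ins (d key : ℕ) (m : Mono) (c : ℤ) (tr tr' : CTree) (u v t : ℝ)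
    (h : ins d key m c tr = some tr') : tr'.eval u v t = tr.eval u v t + (c : ℝ) * m.eval u v t := by
  induction d generalizing key tr tr' with
  | zero =>
    cases tr with
    | empty => simp [ins] at h; subst h; simp [eval]
    | leaf m' c' =>
      simp only [ins] at h
      by_cases hm : m = m'
      · rw [if_pos hm] at h; simp at h; subst h; subst hm; simp only [eval]; push_cast; ring
      · rw [if_neg hm] at h; simp at h
    | node l r => simp [ins] at h
  | succ d ih =>
    cases tr with
    | leaf m' c' => simp [ins] at h
    | empty =>
      simp only [ins] at h
      split_ifs at h with hk
      · obtain ⟨l, hl, rfl⟩ := Option.map_eq_some_iff.1 h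
        simp [eval, ih _ _ _ hl]
      · obtain ⟨r, hr, rfl⟩ := Option.map_eq_some_iff.1 h
        simp [eval, ih _ _ _ hr]
    | node l r =>
      simp only [ins] at h
      split_ifs at h with hk
      · obtain ⟨l', hl, rfl⟩ := Option.map_eq_some_iff.1 h
        simp [eval, ih _ _ _ hl]; ring
      · obtain ⟨r', hr, rfl⟩ := Option.map_eq_some_iff.1 h
        simp [eval, ih _ _ _ hr]; ring

/-- Depth of the trie (keys `< 2^16`). [folklore] -/
def DEPTH : ℕ := 16

/-- Insert all terms of a list; `none` on any collision. [folklore] -/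
def insAll : SPoly → CTree → Option CTree
  | [], tr => some tr
  | (m, c) :: rest, tr =>
    match ins DEPTH m.key m c tr with
    | none => none
    | some tr' => insAll rest tr'

/-- Accumulation preserves the value. [folklore] -/
theorem eval_insAll (p : SPoly) (tr tr' : CTree) (u v t : ℝ) (h : insAll p tr = some tr') :
    tr'.eval u v t = tr.eval u v t + SPoly.eval p u v t := by
  induction p generalizing tr tr' with
  | nil => simp [insAll] at h; subst h; simp
  | cons mc rest ih =>
    obtain ⟨m, c⟩ := mc
    simp only [insAll] at h
    split at h
    · simp at h
    · rename_i tr'' htr''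
      rw [ih _ _ h, eval_ins _ _ _ _ _ _ _ _ _ htr'', SPoly.eval_cons]
      ring

/-- Sum of absolute values of the leaf coefficients. [folklore] -/
def absSum : CTree → ℕ
  | empty => 0
  | leaf _ c => c.natAbs
  | node l r => l.absSum + r.absSum

/-- On the unit box, `|eval| ≤ absSum`. [folklore] -/
theorem abs_eval_le (tr : CTree) {u v t : ℝ} (hu : |u| ≤ 1) (hv : |v| ≤ 1) (ht : |t| ≤ 1) :
    |tr.eval u v t| ≤ tr.absSum := by
  induction tr with
  | empty => simp [eval, absSum]
  | leaf m c =>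
    simp only [eval, absSum, abs_mul]
    calc |(c : ℝ)| * |m.eval u v t| ≤ |(c : ℝ)| * 1 := by
          gcongr; exact Mono.abs_eval_le_one _ hu hv ht
      _ = (c.natAbs : ℝ) := by simp [Nat.cast_natAbs, Int.cast_abs]
  | node l r ihl ihr =>
    simp only [eval, absSum, Nat.cast_add]
    exact (abs_add_le _ _).trans (add_le_add ihl ihr)

/-- Accumulate a term list from the empty trie. [folklore] -/
def ofSPoly (p : SPoly) : Option CTree := insAll p empty

/-- The accumulated trie has the value of the list. [folklore] -/
theorem eval_ofSPoly (p : SPoly) (tr : CTree) (u v t : ℝ) (h : ofSPoly p = some tr) :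
    tr.eval u v t = SPoly.eval p u v t := by
  rw [eval_insAll p empty tr u v t h]; simp [eval]

end CTree

/-! ### Residual bound: `|p| ≤ absSum` via the trie -/

/-- `residualBound p n = true` means: the terms of `p` accumulate without collision and the sum of
the absolute values of the accumulated coefficients is `≤ n`. [folklore] -/
def residualBound (p : SPoly) (n : ℕ) : Bool :=
  match CTree.ofSPoly p with
  | none => false
  | some tr => decide (tr.absSum ≤ n)

/-- Soundness of `residualBound`: `|eval p| ≤ n` on the unit box. [folklore] -/
theorem abs_eval_le_of_residualBound (p : SPoly) (n : ℕ) (h : residualBound p n = true)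
    {u v t : ℝ} (hu : |u| ≤ 1) (hv : |v| ≤ 1) (ht : |t| ≤ 1) : |SPoly.eval p u v t| ≤ n := by
  unfold residualBound at h
  split at h
  · simp at h
  · rename_i tr htr
    have hle : tr.absSum ≤ n := by simpa using h
    rw [← CTree.eval_ofSPoly p tr u v t htr]
    exact (CTree.abs_eval_le tr hu hv ht).trans (by exact_mod_cast hle)

/-! ### Weighted sums of squares -/

/-- `Σ_c d_c · ℓ_c²` as a term list, from a list of pairs `(d_c, ℓ_c)`. [folklore] -/
def sqSum : List (ℕ × SPoly) → SPoly
  | [] => []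
  | (d, l) :: rest => SPoly.smul d (SPoly.mul l l) ++ sqSum rest

/-- `sqSum` evaluates to `Σ d_c (eval ℓ_c)²`, hence is nonnegative. [folklore] -/
theorem eval_sqSum_nonneg (ls : List (ℕ × SPoly)) (u v t : ℝ) : 0 ≤ SPoly.eval (sqSum ls) u v t := by
  induction ls with
  | nil => simp [sqSum]
  | cons dl rest ih =>
    obtain ⟨d, l⟩ := dl
    simp only [sqSum, SPoly.eval_append, SPoly.eval_smul, SPoly.eval_mul, Int.cast_natCast]
    have : 0 ≤ (d : ℝ) * (SPoly.eval l u v t * SPoly.eval l u v t) :=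
      mul_nonneg (Nat.cast_nonneg d) (mul_self_nonneg _)
    linarith

end PolyCert

end Literature.Geometry.DiscreteGeometry
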